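import Literature.Analysis.FluidPDE.AxisymmetricVorticityTransport
import Mathlib.Analysis.SpecialFunctions.SmoothTransition
import HarnessLib

/-!
# SwirlFreeBudget, brick for crux K-18.2 (T-18.5): axisymmetric swirl-free CUT-OFF globalisation
# of a field smooth on an axis-centred ball (seat nsreg-p4)

Support file for the DORMANT route `SwirlThreshold` (crux stmt-NavierStokesRegularity-2002) and
planner nsreg-p2's ROUND-18 assembly task T-18.5 (`EtaMoserBound → SwirlFreePolynomialBound`).
The tree's azimuthal-vorticity dictionary (`norm_curl_eq_cylRadius_mul_abs_angVortQuot`,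
`IsAxisymmetric.curl`, `radQuot_eq_div`, …) is stated for fields that are `Cᵏ` on ALL of `ℝ³`,
axisymmetric and swirl free; the swirl-free representative of a suitable weak solution below its
first singular time is axisymmetric and swirl free everywhere (poloidal part) but smooth only inside
an axis-centred region.  This file supplies the standard fix: multiply by a smooth RADIAL bump about
an axis point.  For `c` on the axis, `0 < R' < R`, and `V` of class `Cⁿ` on `ball c R`, axisymmetric
and swirl free, `exists_contDiff_axisymmetric_hasNoSwirl_eqOn` gives `W` with

* `ContDiff ℝ n W`, `IsAxisymmetric W`, `HasNoSwirl W`, and `W = V` on `ball c R'`;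

together with the locality of `radQuot` (`…SwirlFreeBudgetRadQuotLocal`) and the pointwise
dictionary (`…SwirlFreeBudgetLocalVorticity`) this transfers `‖curl V‖ = r |angVortQuot V|` to
`V` at the points of `ball c R'`.  Ingredients: `Real.smoothTransition` (the bump
`χ(y) = smoothTransition((R₁² - ‖y-c‖²)/(R₁² - R'²))`, `R₁ = (R'+R)/2`), `norm_rotZ`, `rotZL`.

WHAT THIS IS NOT: not NS regularity — a cut-off construction; `EtaMoserBound` and all hard cores
untouched; no crux claim.
-/

namespace Summit.NavierStokesRegularity.NavierStokesRegularity.Theorems.SwirlFreeBudget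

open Set Filter Topology Metric
open Literature.Analysis Literature.Analysis.FluidPDE

noncomputable section

/-- Rotations about the axis preserve the distance to an axis point. -/
theorem norm_rotZ_sub_of_cylRadius_eq_zero {c : EuclideanSpace ℝ (Fin 3)} (hc : cylRadius c = 0)
    (θ : ℝ) (x : EuclideanSpace ℝ (Fin 3)) : ‖rotZ θ x - c‖ = ‖x - c‖ := by
  -- rotations about the axis fix the points of the axis
  -- (cf. `…AxisymmetricKatoGlobal.EulerScaling.rotZ_eq_self_of_cylRadius`)
  have hfix : rotZ θ c = c := by
    obtain ⟨hc0, hc1⟩ := (cylRadius_eq_zero_iff c).1 hc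
    ext i
    fin_cases i <;> simp [rotZ_apply_zero, rotZ_apply_one, rotZ_apply_two, hc0, hc1]
  conv_lhs => rw [← hfix]
  rw [← rotZL_apply, ← rotZL_apply, ← map_sub, rotZL_apply, norm_rotZ]

/-- **AXISYMMETRIC SWIRL-FREE CUT-OFF GLOBALISATION.**  For `c` on the axis, `0 < R' < R`, and a
field `V` of class `Cⁿ` on `ball c R` which is axisymmetric and swirl free (everywhere), there is a
globally `Cⁿ`, axisymmetric, swirl-free field `W` equal to `V` on `ball c R'` (`n : ℕ∞`, i.e. up
to `C^∞`; the bump is not analytic). -/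
theorem exists_contDiff_axisymmetric_hasNoSwirl_eqOn {n : ℕ∞}
    {V : EuclideanSpace ℝ (Fin 3) → EuclideanSpace ℝ (Fin 3)} {c : EuclideanSpace ℝ (Fin 3)}
    (hc : cylRadius c = 0) {R R' : ℝ} (hR' : 0 < R') (hRR : R' < R)
    (hV : ContDiffOn ℝ n V (ball c R)) (hax : IsAxisymmetric V) (hsw : HasNoSwirl V) :
    ∃ W : EuclideanSpace ℝ (Fin 3) → EuclideanSpace ℝ (Fin 3),
      ContDiff ℝ n W ∧ IsAxisymmetric W ∧ HasNoSwirl W ∧ EqOn W V (ball c R') := by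
  -- the radial bump `χ`: `= 1` on `ball c R'`, `= 0` outside `closedBall c R₁`, `R₁ = (R' + R)/2`
  set R₁ : ℝ := (R' + R) / 2 with hR₁
  have hR₁' : R' < R₁ := by rw [hR₁]; linarith
  have hR₁R : R₁ < R := by rw [hR₁]; linarith
  have hden : 0 < R₁ ^ 2 - R' ^ 2 := by nlinarith
  set χ : EuclideanSpace ℝ (Fin 3) → ℝ :=
    fun y => Real.smoothTransition ((R₁ ^ 2 - ‖y - c‖ ^ 2) / (R₁ ^ 2 - R' ^ 2)) with hχ
  have hχs : ContDiff ℝ n χ := by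
    have hg : ContDiff ℝ n (fun y : EuclideanSpace ℝ (Fin 3) => (R₁ ^ 2 - ‖y - c‖ ^ 2) / (R₁ ^ 2 - R' ^ 2)) :=
      (contDiff_const.sub ((contDiff_norm_sq ℝ).comp (contDiff_id.sub contDiff_const))).div_const _
    exact Real.smoothTransition.contDiff.comp hg
  have hχ1 : ∀ y ∈ ball c R', χ y = 1 := by
    intro y hy
    have hy' : ‖y - c‖ < R' := by rwa [mem_ball, dist_eq_norm] at hy
    refine Real.smoothTransition.one_of_one_le ?_
    rw [le_div_iff₀ hden]
    nlinarith [norm_nonneg (y - c)]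
  have hχ0 : ∀ y, R₁ ≤ ‖y - c‖ → χ y = 0 := by
    intro y hy
    refine Real.smoothTransition.zero_of_nonpos ?_
    apply div_nonpos_of_nonpos_of_nonneg _ hden.le
    nlinarith [hR'.le, hR₁']
  have hχrot : ∀ θ y, χ (rotZ θ y) = χ y := by
    intro θ y
    simp only [hχ, norm_rotZ_sub_of_cylRadius_eq_zero hc]
  refine ⟨fun y => χ y • V y, ?_, ?_, ?_, ?_⟩
  · -- smoothness: product inside `ball c R`, identically zero near every point outside it
    refine contDiff_iff_contDiffAt.2 fun y => ?_
    by_cases hy : y ∈ ball c R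
    · exact hχs.contDiffAt.smul (hV.contDiffAt (isOpen_ball.mem_nhds hy))
    · have hfar : R ≤ ‖y - c‖ := by
        rw [mem_ball, dist_eq_norm, not_lt] at hy; exact hy
      -- near `y`, `‖z - c‖ > R₁`, so the product vanishes
      have hev : (fun z : EuclideanSpace ℝ (Fin 3) => χ z • V z) =ᶠ[𝓝 y] fun _ => 0 := by
        have hopen : IsOpen {z : EuclideanSpace ℝ (Fin 3) | R₁ < ‖z - c‖} :=
          isOpen_lt continuous_const ((continuous_id.sub continuous_const).norm)
        have hmem : y ∈ {z : EuclideanSpace ℝ (Fin 3) | R₁ < ‖z - c‖} := lt_of_lt_of_le hR₁R hfar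
        filter_upwards [hopen.mem_nhds hmem] with z hz
        rw [hχ0 z (le_of_lt hz), zero_smul]
      exact (contDiffAt_const.congr_of_eventuallyEq hev)
  · -- axisymmetry: `χ` is invariant, `V` is equivariant, `rotZ θ` is linear
    intro θ y
    show χ (rotZ θ y) • V (rotZ θ y) = rotZ θ (χ y • V y)
    rw [hχrot, hax θ y, ← rotZL_apply, ← rotZL_apply, map_smul]
  · -- no swirl: `swirl (χ • V) = χ · swirl V = 0`
    intro y
    have h := hsw y
    simp only [swirl, PiLp.smul_apply, smul_eq_mul] at h ⊢
    linear_combination χ y * h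
  · intro y hy
    show χ y • V y = V y
    rw [hχ1 y hy, one_smul]

end

end Summit.NavierStokesRegularity.NavierStokesRegularity.Theorems.SwirlFreeBudget
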